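import Summits.ResolutionOfSingularities.ResolutionOfSingularities.Theses.Valuative
import Literature.AlgebraicGeometry.Resolution.ResolutionLU

/-!
# ResolutionOfSingularities / Valuative — `LurelOfResolution` (stmt-ResolutionOfSingularities-0739)

Route `ResolutionOfSingularities/Valuative`, support item `LurelOfResolution` (rank 9): faithfulness
of the relative pivot, `ResolutionInChar p → LUrel_p` — resolution of singularities in
characteristic `p` implies RELATIVE Zariski local uniformization in characteristic `p`: for every
finitely generated field extension `K/k` with `char k = p`, every valuation ring `O ⊇ k` of `K` and
every finitely generated `k`-subalgebra `R ⊆ O` there is a finitely generated `k`-subalgebra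
`R ⊆ A ⊆ O` with `Frac A = K` whose localisation at the centre `𝔪_O ∩ A` is a regular local ring.

The mathematics (folklore; Zariski 1940, Novacoski–Spivakovsky 2016 §2: enlarge `R` by an affine
model of `O`, resolve `Spec` of it, lift `Spec O` to the regular model by the valuative criterion of
properness, take an affine chart at the centre) is the tree theorem
`Literature.AlgebraicGeometry.Resolution.lurel_of_resolutionInChar`
(`Literature/AlgebraicGeometry/Resolution/ResolutionLU.lean`), whose statement is the route decl
verbatim; this file only records that the item closes.
-/

-- `Summit.<Summit>.<Sub>.Theorems` with `Sub = Summit` (single-conjunct summit, D-0017): the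
-- duplicated namespace component is the tree layout.
set_option linter.dupNamespace false

namespace Summit.ResolutionOfSingularities.ResolutionOfSingularities.Theorems

/-- Settles `stmt-ResolutionOfSingularities-0739` (route `Valuative`, support `LurelOfResolution`):
resolution of singularities in characteristic `p` (`ResolutionInChar.{0} p`) implies relative local
uniformization `LUrel_p` — every finitely generated `R ⊆ O` (`O ⊇ k` a valuation ring of a finitely
generated extension `K/k`, `char k = p`) is dominated by a finitely generated `R ⊆ A ⊆ O` with
`Frac A = K` and `A_{𝔪_O ∩ A}` regular. Proof: the route decl is literally
`Literature.AlgebraicGeometry.Resolution.lurel_of_resolutionInChar` (valuative criterion of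
properness applied to a resolution of an affine model of `O` containing `R`). [folklore] -/
theorem lurelOfResolution_proof :
    Summit.ResolutionOfSingularities.ResolutionOfSingularities.Theses.Valuative.LurelOfResolution := by
  unfold Summit.ResolutionOfSingularities.ResolutionOfSingularities.Theses.Valuative.LurelOfResolution
  exact Literature.AlgebraicGeometry.Resolution.lurel_of_resolutionInChar

end Summit.ResolutionOfSingularities.ResolutionOfSingularities.Theorems
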